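import Mathlib
import Summits.ValiantsHypothesis.ValiantsHypothesis.Theorems.GrenetZeonPolySizeQPAlgebraBlockNormalFormGeneral
import Summits.ValiantsHypothesis.ValiantsHypothesis.Theorems.GrenetZeonPolySizeQPAlgebraResidualCorankOne
import Summits.ValiantsHypothesis.ValiantsHypothesis.Theorems.GrenetZeonPolySizeQPAlgebraCorankTwoForms
import HarnessLib

/-!
# Crux `GrenetZeon.PolySizeQPAlgebra` (stmt-ValiantsHypothesis-8064), line `vbp-slice-dealg` —
# the local Hessian bound at normal forms `diag(1_κ, S)` with `adj S = 0 = det S`; square-zero ideals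

First consequences of the general-`q` closed form (`…BlockNormalFormGeneral`) for the remaining input
`LocalHessianBound₃` (residual corank `q ≥ 3`, `…LocalReductionResidualThree`):

* `det_eq_zero_of_two_rows_mem_sqZero`, `det_eq_zero_of_mem_sqZero`, `adjugate_eq_zero_of_mem_sqZero`,
  `det_updateRow_updateRow_eq_zero_of_mem_sqZero` — matrices with entries in an ideal `I` with
  `I · I = 0`: `det = 0` from size `2`, `adj = 0` from size `3`, all double row replacements singular from
  size `4` (every Leibniz term contains two entries of `I`).
* `eval_pderiv_pderiv_det_eq_zero_of_sqZero`, `hess0_transl_eq_zero_of_sqZero` — **at a normal form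
  `A(p) = diag(1_κ, S)` with `S ∈ Mat_q(I)`, `I² = 0`, `q ≥ 4`, the Hessian of `λ(det A)` at `p` VANISHES.**
* `rank_secondPolar_readOut_le` — the read-out of the second polarisation
  `(s,t) ↦ λ(Σ_r Σ_{q'≠r} det(S | row r ← (Y_t)_r, row q' ← (X_s)_{q'}))` has rank `≤ |m|²·dim R`
  (linear in `X_s ∈ Mat_m(R)`), for every `S`.
* `rank_hess0_transl_le_of_adjugate_eq_zero` — at a normal form with `adj S = 0 = det S` (e.g.
  `S ∈ Mat_q(𝔪)`, `𝔪^{q-1} = 0`) only the second polarisation survives: `rank Hess F(p) ≤ q²·dim R`.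
* `rank_hess0_transl_le_of_sqZero` — hence the local Hessian bound `≤ 2·dim R·(|κ|+q)` at square-zero
  normal forms of size `q ≥ 3` whenever `q² ≤ 2(|κ| + q)` (all `q ≥ 4` trivially by the vanishing; `q = 3`
  for `|κ| ≥ 2`, i.e. `n ≥ 5`).

What is NOT here: the transport of an arbitrary `A(p)` of residual rank exactly `|κ|` to such a normal
form with `S ∈ Mat_q(𝔪)` (needs the maximal unit minor; `…ResidualCorankTwo` transports with any unit
minor but does not record `S ∈ Mat(𝔪)`), and the `q = 3`, `n ≤ 4` corner (needs the residue refinement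
`I · 𝔪 = 0`).  HONEST FRAMING: rank counts at normal forms; no stub of the line is closed; VP ≠ VNP is not
moved.

References: T. Mignon, N. Ressayre, IMRN 2004:79, §2 [MignonRessayre2004].
-/

noncomputable section

open MvPolynomial Matrix
open Literature.Computability.AlgebraicComplexity

-- single-conjunct layout `Summits/ValiantsHypothesis/ValiantsHypothesis`: duplicated namespace by design
set_option linter.dupNamespace false

namespace Summit.ValiantsHypothesis.ValiantsHypothesis.Theorems.GrenetZeonPolySizeQPAlgebra

section SquareZero

variable {R : Type*} [CommRing R] {m : Type*} [Fintype m] [DecidableEq m]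

/-- **Two rows in a square-zero ideal kill the determinant.**  If the entries of two distinct rows of
`M` lie in an ideal `I` with `I · I = 0`, then `det M = 0` (every Leibniz term contains one entry from each
of the two rows). [folklore] -/
theorem det_eq_zero_of_two_rows_mem_sqZero (I : Ideal R) (hI : ∀ a ∈ I, ∀ b ∈ I, a * b = 0)
    (M : Matrix m m R) {r₁ r₂ : m} (hne : r₁ ≠ r₂) (h₁ : ∀ j, M r₁ j ∈ I) (h₂ : ∀ j, M r₂ j ∈ I) :
    M.det = 0 := by
  rw [Matrix.det_apply]
  refine Finset.sum_eq_zero fun σ _ => ?_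
  have hi : σ.symm r₁ ≠ σ.symm r₂ := fun h => hne (σ.symm.injective h)
  have hprod : ∏ i, M (σ i) i = 0 := by
    rw [← Finset.mul_prod_erase Finset.univ _ (Finset.mem_univ (σ.symm r₁)),
      ← Finset.mul_prod_erase _ _ (Finset.mem_erase.2 ⟨hi.symm, Finset.mem_univ (σ.symm r₂)⟩),
      ← mul_assoc, Equiv.apply_symm_apply, Equiv.apply_symm_apply, hI _ (h₁ _) _ (h₂ _), zero_mul]
  rw [hprod, smul_zero]

/-- A square matrix of size `≥ 2` with all entries in a square-zero ideal has determinant `0`.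
[folklore] -/
theorem det_eq_zero_of_mem_sqZero (I : Ideal R) (hI : ∀ a ∈ I, ∀ b ∈ I, a * b = 0)
    (S : Matrix m m R) (hS : ∀ i j, S i j ∈ I) (hm : 2 ≤ Fintype.card m) : S.det = 0 := by
  obtain ⟨r₁, r₂, -, -, hne⟩ := Finset.one_lt_card_iff.1
    (show 1 < (Finset.univ : Finset m).card by rw [Finset.card_univ]; omega)
  exact det_eq_zero_of_two_rows_mem_sqZero I hI S hne (hS r₁) (hS r₂)

/-- A square matrix of size `≥ 3` with all entries in a square-zero ideal has adjugate `0` (its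
`(q-1)`-minors have two rows in the ideal). [folklore] -/
theorem adjugate_eq_zero_of_mem_sqZero (I : Ideal R) (hI : ∀ a ∈ I, ∀ b ∈ I, a * b = 0)
    (S : Matrix m m R) (hS : ∀ i j, S i j ∈ I) (hm : 3 ≤ Fintype.card m) : S.adjugate = 0 := by
  ext i j
  rw [Matrix.adjugate_apply, Matrix.zero_apply]
  obtain ⟨r₁, r₂, hr₁, hr₂, hne⟩ := Finset.one_lt_card_iff.1
    (show 1 < ((Finset.univ : Finset m).erase j).card by
      rw [Finset.card_erase_of_mem (Finset.mem_univ j), Finset.card_univ]; omega)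
  have hr₁j : r₁ ≠ j := (Finset.mem_erase.1 hr₁).1
  have hr₂j : r₂ ≠ j := (Finset.mem_erase.1 hr₂).1
  refine det_eq_zero_of_two_rows_mem_sqZero I hI _ hne (fun c => ?_) (fun c => ?_)
  · rw [Matrix.updateRow_ne hr₁j]; exact hS _ _
  · rw [Matrix.updateRow_ne hr₂j]; exact hS _ _

/-- With all entries of `S` in a square-zero ideal and size `≥ 4`, every determinant obtained from `S` by
replacing two rows vanishes (two rows of `S` remain). [folklore] -/
theorem det_updateRow_updateRow_eq_zero_of_mem_sqZero (I : Ideal R) (hI : ∀ a ∈ I, ∀ b ∈ I, a * b = 0)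
    (S : Matrix m m R) (hS : ∀ i j, S i j ∈ I) (hm : 4 ≤ Fintype.card m) (r q : m) (y x : m → R) :
    ((S.updateRow r y).updateRow q x).det = 0 := by
  obtain ⟨r₁, r₂, hr₁, hr₂, hne⟩ := Finset.one_lt_card_iff.1
    (show 1 < (((Finset.univ : Finset m).erase r).erase q).card by
      have h1 : ((Finset.univ : Finset m).erase r).card = Fintype.card m - 1 := by
        rw [Finset.card_erase_of_mem (Finset.mem_univ r), Finset.card_univ]
      have h2 := Finset.card_erase_le (s := (Finset.univ : Finset m).erase r) (a := q)
      have h3 : (((Finset.univ : Finset m).erase r).erase q).card ≥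
          ((Finset.univ : Finset m).erase r).card - 1 := Finset.pred_card_le_card_erase
      omega)
  have hr₁q : r₁ ≠ q := (Finset.mem_erase.1 hr₁).1
  have hr₁r : r₁ ≠ r := (Finset.mem_erase.1 (Finset.mem_erase.1 hr₁).2).1
  have hr₂q : r₂ ≠ q := (Finset.mem_erase.1 hr₂).1
  have hr₂r : r₂ ≠ r := (Finset.mem_erase.1 (Finset.mem_erase.1 hr₂).2).1
  refine det_eq_zero_of_two_rows_mem_sqZero I hI _ hne (fun c => ?_) (fun c => ?_)
  · rw [Matrix.updateRow_ne hr₁q, Matrix.updateRow_ne hr₁r]; exact hS _ _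
  · rw [Matrix.updateRow_ne hr₂q, Matrix.updateRow_ne hr₂r]; exact hS _ _

variable {σ : Type*} [DecidableEq σ] {κ : Type*} [Fintype κ] [DecidableEq κ]

/-- **At residual corank `≥ 4` over a square-zero ideal the second partials of `det A` vanish.**  If
`A` is affine with `A(x) = diag(1_κ, S)`, all entries of `S` in an ideal `I` with `I · I = 0`, and `S` has
size `≥ 4`, then `∂_s ∂_t det A (x) = 0` for all `s, t`: in the closed form of
`eval_pderiv_pderiv_det_blockNormalForm_general`, `adj S = 0`, `det S = 0`, and every double row
replacement of `S` keeps two rows in `I`. [folklore] -/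
theorem eval_pderiv_pderiv_det_eq_zero_of_sqZero (I : Ideal R) (hI : ∀ a ∈ I, ∀ b ∈ I, a * b = 0)
    (x : σ → R) (s t : σ) (A : Matrix (κ ⊕ m) (κ ⊕ m) (MvPolynomial σ R))
    (hA : ∀ i j, (A i j).totalDegree ≤ 1) (S : Matrix m m R)
    (hB : A.map (eval x) = Matrix.fromBlocks 1 0 0 S) (hS : ∀ i j, S i j ∈ I)
    (hm : 4 ≤ Fintype.card m) : eval x (pderiv s (pderiv t A.det)) = 0 := by
  rw [eval_pderiv_pderiv_det_blockNormalForm_general x s t A hA S hB _ _ rfl rfl,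
    adjugate_eq_zero_of_mem_sqZero I hI S hS (by omega), det_eq_zero_of_mem_sqZero I hI S hS (by omega)]
  simp only [Matrix.zero_mul, Matrix.trace_zero, mul_zero, add_zero,
    det_updateRow_updateRow_eq_zero_of_mem_sqZero I hI S hS hm, ite_self, Finset.sum_const_zero]

variable [Algebra ℂ R]

/-- **Local Hessian bound at a square-zero normal form of residual corank `≥ 4`: the Hessian is `0`.**
For `F = λ(det A)` with `A(p) = diag(1_κ, S)`, `S ∈ Mat_q(I)`, `I² = 0`, `q ≥ 4`:
`Hess F(p) = 0`, in particular `rank Hess F(p) ≤ 2 · dim R · n`. [folklore] -/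
theorem hess0_transl_eq_zero_of_sqZero (I : Ideal R) (hI : ∀ a ∈ I, ∀ b ∈ I, a * b = 0)
    (l : R →ₗ[ℂ] ℂ) (A : Matrix (κ ⊕ m) (κ ⊕ m) (MvPolynomial σ R)) (F : MvPolynomial σ ℂ)
    (hA : ∀ a b, (A a b).totalDegree ≤ 1) (hF : ∀ d, l (coeff d A.det) = coeff d F)
    (p : σ → ℂ) (S : Matrix m m R)
    (hB : A.map (eval fun i => algebraMap ℂ R (p i)) = Matrix.fromBlocks 1 0 0 S)
    (hS : ∀ i j, S i j ∈ I) (hm : 4 ≤ Fintype.card m) : hess0 (transl p F) = 0 := by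
  ext s t
  rw [hess0_transl_readOut l hF p s t,
    eval_pderiv_pderiv_det_eq_zero_of_sqZero I hI _ s t A hA S hB hS hm, map_zero, Matrix.zero_apply]

end SquareZero

/-! ### When `adj S = 0 = det S`: only the second polarisation survives; its read-out has small rank -/

section SecondPolar

variable {R : Type*} [CommRing R] [Algebra ℂ R] [Module.Finite ℂ R] {m : Type*} [Fintype m] [DecidableEq m]
  {σ : Type*} [Fintype σ]

/-- **Rank of the second-polarisation read-out.**  For any `S ∈ Mat_m(R)` and families `X_s, Y_t` of
`m × m` matrices over `R`, the matrix `(s,t) ↦ λ(Σ_r Σ_{q≠r} det(S | row r ← (Y_t)_r, row q ← (X_s)_q))`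
has rank `≤ |m|² · dim_ℂ R`: it is `ℂ`-linear in `X_s ∈ Mat_m(R)` (determinants are linear in a row), so it
factors through `Mat_m(R)`. [folklore] -/
theorem rank_secondPolar_readOut_le (l : R →ₗ[ℂ] ℂ) (S : Matrix m m R) (Xf Yf : σ → Matrix m m R) :
    (Matrix.of fun s t => l (∑ r, ∑ q, if q = r then 0 else
        ((S.updateRow r (Yf t r)).updateRow q (Xf s q)).det)).rank ≤
      Fintype.card m * Fintype.card m * Module.finrank ℂ R := by
  classical
  -- the functionals `M ↦ λ(Σ_r Σ_{q≠r} det(S | r ← (Y_t)_r, q ← M_q))`, linear in `M`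
  have hadd : ∀ (t : σ) (M N : Matrix m m R),
      (∑ r, ∑ q, if q = r then (0 : R) else ((S.updateRow r (Yf t r)).updateRow q ((M + N) q)).det) =
      (∑ r, ∑ q, if q = r then (0 : R) else ((S.updateRow r (Yf t r)).updateRow q (M q)).det) +
        ∑ r, ∑ q, if q = r then (0 : R) else ((S.updateRow r (Yf t r)).updateRow q (N q)).det := by
    intro t M N
    rw [← Finset.sum_add_distrib]
    refine Finset.sum_congr rfl fun r _ => ?_
    rw [← Finset.sum_add_distrib]
    refine Finset.sum_congr rfl fun q _ => ?_
    split_ifs with h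
    · rw [add_zero]
    · rw [show (M + N) q = M q + N q from rfl, Matrix.det_updateRow_add]
  have hsmul : ∀ (t : σ) (a : ℂ) (M : Matrix m m R),
      (∑ r, ∑ q, if q = r then (0 : R) else ((S.updateRow r (Yf t r)).updateRow q ((a • M) q)).det) =
      algebraMap ℂ R a * ∑ r, ∑ q, if q = r then (0 : R) else
        ((S.updateRow r (Yf t r)).updateRow q (M q)).det := by
    intro t a M
    rw [Finset.mul_sum]
    refine Finset.sum_congr rfl fun r _ => ?_
    rw [Finset.mul_sum]
    refine Finset.sum_congr rfl fun q _ => ?_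
    split_ifs with h
    · rw [mul_zero]
    · rw [show (a • M) q = algebraMap ℂ R a • M q by
        funext j; simp [Matrix.smul_apply, Algebra.smul_def], Matrix.det_updateRow_smul]
  let ψ : σ → (Matrix m m R →ₗ[ℂ] ℂ) := fun t =>
    { toFun := fun M => l (∑ r, ∑ q, if q = r then 0 else
        ((S.updateRow r (Yf t r)).updateRow q (M q)).det)
      map_add' := fun M N => by rw [hadd, map_add]
      map_smul' := fun a M => by rw [hsmul, ← Algebra.smul_def, map_smul, RingHom.id_apply] }
  have h : (Matrix.of fun s t => l (∑ r, ∑ q, if q = r then 0 else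
      ((S.updateRow r (Yf t r)).updateRow q (Xf s q)).det)) = Matrix.of fun s t => ψ t (Xf s) := by
    ext s t; rfl
  rw [h]
  refine (rank_linear_readOut_le Xf ψ).trans ?_
  rw [Module.finrank_matrix ℂ R m m]

variable [DecidableEq σ] {κ : Type*} [Fintype κ] [DecidableEq κ]

/-- **Local Hessian bound at a normal form `diag(1_κ, S)` with `adj S = 0 = det S`.**  Then only the
second polarisation survives in `eval_pderiv_pderiv_det_blockNormalForm_general`, and
`rank Hess λ(det A)(p) ≤ |m|² · dim_ℂ R`.  (`adj S = 0 = det S` holds e.g. for `S ∈ Mat_q(𝔪)` with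
`𝔪^{q-1} = 0`, in particular for square-zero `𝔪` and `q ≥ 3`: `adjugate_eq_zero_of_mem_sqZero`.)
[cite: MignonRessayre2004, §2] -/
theorem rank_hess0_transl_le_of_adjugate_eq_zero (l : R →ₗ[ℂ] ℂ)
    (A : Matrix (κ ⊕ m) (κ ⊕ m) (MvPolynomial σ R)) (F : MvPolynomial σ ℂ)
    (hA : ∀ a b, (A a b).totalDegree ≤ 1) (hF : ∀ d, l (coeff d A.det) = coeff d F)
    (p : σ → ℂ) (S : Matrix m m R)
    (hB : A.map (eval fun i => algebraMap ℂ R (p i)) = Matrix.fromBlocks 1 0 0 S)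
    (hadj : S.adjugate = 0) (hdet : S.det = 0) :
    (hess0 (transl p F)).rank ≤ Fintype.card m * Fintype.card m * Module.finrank ℂ R := by
  classical
  set x : σ → R := fun i => algebraMap ℂ R (p i) with hx
  set Xf : σ → Matrix m m R := fun s => (A.map fun a => eval x (pderiv s a)).toBlocks₂₂ with hXf
  have hH : hess0 (transl p F) = Matrix.of fun s t => l (∑ r, ∑ q, if q = r then 0 else
      ((S.updateRow r (Xf t r)).updateRow q (Xf s q)).det) := by
    ext s t
    rw [hess0_transl_readOut l hF p s t,
      eval_pderiv_pderiv_det_blockNormalForm_general x s t A hA S hB _ _ rfl rfl, hadj, hdet,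
      Matrix.of_apply]
    simp only [Matrix.zero_mul, Matrix.trace_zero, mul_zero, add_zero, zero_add, hXf]
  rw [hH]
  exact rank_secondPolar_readOut_le l S Xf Xf

/-- **Square-zero residual block of size `3`** (or any size `q ≥ 3` with `q² ≤ 2(|κ| + q)`): for
`A(p) = diag(1_κ, S)` with all entries of `S` in an ideal `I`, `I · I = 0`, `|m| ≥ 3` and
`|m|² ≤ 2 (|κ| + |m|)`, the local Hessian bound `rank Hess F(p) ≤ 2 · dim R · (|κ| + |m|)` holds.
[cite: MignonRessayre2004, §2] -/
theorem rank_hess0_transl_le_of_sqZero (I : Ideal R) (hI : ∀ a ∈ I, ∀ b ∈ I, a * b = 0)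
    (l : R →ₗ[ℂ] ℂ) (A : Matrix (κ ⊕ m) (κ ⊕ m) (MvPolynomial σ R)) (F : MvPolynomial σ ℂ)
    (hA : ∀ a b, (A a b).totalDegree ≤ 1) (hF : ∀ d, l (coeff d A.det) = coeff d F)
    (p : σ → ℂ) (S : Matrix m m R)
    (hB : A.map (eval fun i => algebraMap ℂ R (p i)) = Matrix.fromBlocks 1 0 0 S)
    (hS : ∀ i j, S i j ∈ I) (hm : 3 ≤ Fintype.card m)
    (hkm : Fintype.card m * Fintype.card m ≤ 2 * (Fintype.card κ + Fintype.card m)) :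
    (hess0 (transl p F)).rank ≤ 2 * Module.finrank ℂ R * (Fintype.card κ + Fintype.card m) := by
  refine (rank_hess0_transl_le_of_adjugate_eq_zero l A F hA hF p S hB
    (adjugate_eq_zero_of_mem_sqZero I hI S hS hm) (det_eq_zero_of_mem_sqZero I hI S hS (by omega))).trans ?_
  calc Fintype.card m * Fintype.card m * Module.finrank ℂ R
      ≤ 2 * (Fintype.card κ + Fintype.card m) * Module.finrank ℂ R := Nat.mul_le_mul_right _ hkm
    _ = 2 * Module.finrank ℂ R * (Fintype.card κ + Fintype.card m) := by ring

end SecondPolar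

end Summit.ValiantsHypothesis.ValiantsHypothesis.Theorems.GrenetZeonPolySizeQPAlgebra

end
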